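import Literature.AnabelianGeometry.EtaleTheta.SettingModelChiInversionAut
import Literature.AnabelianGeometry.EtaleTheta.SettingModelChiMuTwoInversion
import Literature.AnabelianGeometry.EtaleTheta.Discharge.Sec2OrbitEmbeddingOuterTransport
import HarnessLib

/-!
# [EtTh] Rmk. 1.9.1 / Cor. 2.8 (iii) at the χ-model: P-C5 — how the automorphism pair of an OUTER conjugator
# of `Π^tp_C = Π^tp_X ⋊_ι ℤ/2` moves the model's étale theta class (proof-only)

S. Mochizuki, *The étale theta function …* [EtTh], Publ. RIMS **45** (2009): Rmk. 1.9.1 PRIMS p. 29 («any inner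
automorphism of `Π^tp_Ċ` … η̈^{Θ,ℤ} ↦ η̈^{Θ,ℤ}»), Prop. 2.2 (i) p. 37 (`ι` acts by `+1` on `Δ̄_Θ`, `−1` on `Δ̄^ell`),
Cor. 2.8 (iii) p. 42, Prop. 1.5 (iii) p. 23 (inversion automorphisms) [cite: MochizukiEtTh2009, Rmk 1.9.1 p.29].
abc-iut cell, layer L2, seat abc-iut-w6-d083 (gen 3), row «P-C5 AT THE χ-MODEL» (abc-iut-L2-lead gen 4 R247;
GAP-LEDGER G-w6d049-1).  PROOF-ONLY (0 `def`, 0 `instance`; nothing of another seat restated) over abc-iut-L2-d1's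
theta cocycle of the χ-model and INVERSION files (`SettingModelChiThetaCocycle`; `SettingModelChiInversionTheta`
p440780: `thm16i_twistedInversion_modelχ`, transport form `transport_etaDdχ_twistedInversion`;
`SettingModelChiInversionAut` p442712: `isInversionAut_twistedInversion_modelχ` — all consumed BY NAME),
abc-iut-L2-t1/w5-d072's `twistedInversionTop (chi p)` with abc-iut-L2-t10's riders (`SettingModelChiCensusClauses`),
abc-iut-L2-t1's `levelHom_gfpInv = negXY`, `gfpInv_mem_dY_iff`/`_dZ_iff` (`SettingModel2InversionCoverings`),
abc-iut-w5-d140's `Π^tp_C := Π^tp_X ⋊_ι ℤ/2` (`SettingModelChiMuTwoInversion`: `PiCInvχ`, `inclInvχ`, `invActionχ`),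
abc-iut-L6-t1's `ContH1Aut.autMap`, abc-iut-w6-d051's `symm_toTheta_eq` / `autMap_symm_eq_conj`
(`Sec2OrbitEmbeddingOuterTransport`), abc-iut-L2-t1's ROOT predicate `IsInversionAut` (`ThetaCohomologyInversion`).

THE CONSUMER'S BINDER: the reduced OUTER capstones of EtTh:Cor2.8(iii)/(i) (abc-iut-w6-d051
`ofEmbedding_cor28_iii_outer_reduced`, p437630; abc-iut-w6-d049 p436513) carry `hη : autMap α⁻¹ β⁻¹ η̈^Θ =
ContH1.conj σ₀ η̈^Θ` for an outer conjugator `x` with pair `(α, β)` through the embedding of `Π^tp_X`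
(`ι ∘ α = conj_x ∘ ι`, `β ∘ θ = θ ∘ α`).  THIS FILE proves it at abc-iut-L2-t1's `modelχ p` for the model class
`etaDdχ p`, for EVERY `x ∈ Π^tp_C := PiCInvχ p` and EVERY pair through `inclInvχ`, in that exact `autMap α.symm β.symm`
form (arbitrary `β`, arbitrary membership proofs) with an EXPLICIT `σ₀`:
* (§1 = abc-iut-L2-d1's `isInversionAut_twistedInversion_modelχ`, p442712: `ι` is an `IsInversionAut` — imported.)
* §2 `toTheta_twistedInversion_of_mem_ellKer` (`+1` on `Δ_Θ`); a `β` compatible with `conj_y ∘ ι` acts on `Δ_Θ` as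
  conjugation by `θ(y)` (`apply_eq_conj_of_mem_deltaTheta`);
* §3 `toTheta_inl_centreRep_gfpInv` — the theta cocycle has the same value at `g` and `ι g`;
* §4 **`autMap_symm_etaDdχ_outer`** — for `α = conj_y ∘ ι`: `autMap α⁻¹ β⁻¹ η̈^Θ = ContH1.conj (ι y)⁻¹ η̈^Θ`, an
  identity of COCYCLES (witness `(ι y)⁻¹`, not `y⁻¹`: they differ by the `Z`-translate of degree `2·deg y`); the
  inversion alone (`σ₀ = 1`) and the inner case (`σ₀ = y⁻¹`);
* §5 **`exists_autMap_symm_etaDdχ_eq_conj`** — every `x : PiCInvχ p`, every pair: `σ₀ = (φ_{x₂} x₁)⁻¹`; also valid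
  verbatim for `E := etaleThetaDataχSec p (etaDdχ p)` (`E.etaDd` unfolds to `etaDdχ p`).
RESIDUAL (R247 census line): the junction «`σ₀ ∈ ε.dotXuu` / `σ₀ ∈ C.Huu`» needs abc-iut-L2-d3's `OrbitEmbedding` at
the model (not landed); with it `x ∈ Π^tp_{Ċ̲̲}` reads `x₁ ∈ Π^tp_{Ẋ̲̲}` and `σ₀ ∈ Π^tp_{Ẋ̲̲}` by `ι`-stability.
HONEST LIMITS: semi-synthetic model (the theta class OF THE MODEL), consistency evidence for the typed interface
only; [EtTh] is refereed, nothing of it is asserted; no side is taken on [IUTchIII] Cor. 3.12; typed ≠ proved.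
-/

noncomputable section

namespace Literature.AnabelianGeometry.EtaleTheta.SettingModel

open Literature.AnabelianGeometry.SemiGraphs Literature.IUT.HodgeArakelov _root_.Function
open ThetaSetting.EtaleThetaData.DoubleUnderline.OrbitEmbedding (symm_toTheta_eq)

variable (p : ℕ) [Fact p.Prime]

/-! ## §2. `ι` is `+1` on `Δ_Θ`; what a compatible `β` does on `Δ_Θ` (§1 = abc-iut-L2-d1's p442712) -/

/-- **`ι` acts by `+1` on `Δ_Θ`**: for `u ∈ Ker(Π^tp_X ↠ (Π^tp_X)^ell)` (i.e. `θ(u) ∈ Δ_Θ`), `θ(ι u) = θ(u)` —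
the levels `(0, 0, z)` of `u` are fixed by `negXY`. [cite: MochizukiEtTh2009, Prop 2.2 (i) p.37] -/
theorem toTheta_twistedInversion_of_mem_ellKer {u : PiTpχ p} (hu : u ∈ CurveTheta.ellKer (curveχ p)) :
    (ThetaSetting.modelχ p).toTheta (twistedInversionTop (chi p) (isInducing_leftRightχ p) u) =
      (ThetaSetting.modelχ p).toTheta u := by
  obtain ⟨hxy, hu1⟩ := (mem_ellKerχ_iff p u).mp hu
  change CurveTheta.toTheta (curveχ p) (twistedInversion (chi p) u) = CurveTheta.toTheta (curveχ p) u
  refine toTheta_eq_of_right_eq_one p _ _ (by rw [twistedInversion_right, hu1]) hu1 ?_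
  rw [mem_closure_commutator₃_iff_forall_hHat]
  intro N
  rw [twistedInversion_left, map_mul, map_inv]
  have h : hHat N (gfpFst (gfpInv u.left)) = Heis.negXY (hHat N (gfpFst u.left)) := levelHom_gfpInv N u.left
  obtain ⟨hx, hy⟩ := hxy N
  rw [h]
  ext <;> simp [hx, hy]

/-- **A `β` compatible with `conj_y ∘ ι` acts on `Δ_Θ` as conjugation by `θ(y)`**: if
`β (θ g) = θ (y · ι g · y⁻¹)` for all `g`, then `β t = θ(y) · t · θ(y)⁻¹` for `t ∈ Δ_Θ` (`θ` surjective,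
`ι` trivial on `Δ_Θ`).  For `y = 1`: `β` FIXES `Δ_Θ` pointwise. [cite: MochizukiEtTh2009, Prop 2.2 (i) p.37] -/
theorem apply_eq_conj_of_mem_deltaTheta (y : PiTpχ p)
    (β : (ThetaSetting.modelχ p).GtpTheta ≃ₜ* (ThetaSetting.modelχ p).GtpTheta)
    (hβ : ∀ g, β ((ThetaSetting.modelχ p).toTheta g) =
      (ThetaSetting.modelχ p).toTheta (y * twistedInversionTop (chi p) (isInducing_leftRightχ p) g * y⁻¹))
    {t : (ThetaSetting.modelχ p).GtpTheta} (ht : t ∈ (ThetaSetting.modelχ p).DeltaTheta) :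
    β t = (ThetaSetting.modelχ p).toTheta y * t * ((ThetaSetting.modelχ p).toTheta y)⁻¹ := by
  obtain ⟨u, rfl⟩ := (ThetaSetting.modelχ p).toTheta_surjective t
  rw [hβ, map_mul, map_mul, map_inv,
    toTheta_twistedInversion_of_mem_ellKer p ((CurveTheta.mk_mem_ker_thetaToEll_iff (curveχ p) u).mp ht)]

/-- The inverse form: such a `β` satisfies `β⁻¹ t = θ(y)⁻¹ · t · θ(y)` on `Δ_Θ`.
[cite: MochizukiEtTh2009, Prop 2.2 (i) p.37] -/
theorem symm_apply_eq_conj_of_mem_deltaTheta (y : PiTpχ p)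
    (β : (ThetaSetting.modelχ p).GtpTheta ≃ₜ* (ThetaSetting.modelχ p).GtpTheta)
    (hβ : ∀ g, β ((ThetaSetting.modelχ p).toTheta g) =
      (ThetaSetting.modelχ p).toTheta (y * twistedInversionTop (chi p) (isInducing_leftRightχ p) g * y⁻¹))
    {t : (ThetaSetting.modelχ p).GtpTheta} (ht : t ∈ (ThetaSetting.modelχ p).DeltaTheta) :
    β.symm t = ((ThetaSetting.modelχ p).toTheta y)⁻¹ * t * (ThetaSetting.modelχ p).toTheta y := by
  apply β.injective
  have ht' : ((ThetaSetting.modelχ p).toTheta y)⁻¹ * t * (ThetaSetting.modelχ p).toTheta y ∈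
      (ThetaSetting.modelχ p).DeltaTheta :=
    (ThetaSetting.modelχ p).deltaTheta_normal.conj_mem' _ ht _
  · rw [ContinuousMulEquiv.apply_symm_apply, apply_eq_conj_of_mem_deltaTheta p y β hβ ht']
    group

/-! ## §3. The theta cocycle takes the same value at `g` and `ι g` -/

/-- **The theta cocycle's value is `ι`-invariant**: for `γ ∈ Ker pr₂` (the `Γ`-part of an element of `Π^tp_Y`),
`θ(inl(centreRep (ι_Γ γ))) = θ(inl(centreRep γ))` — both have levels `(0, 0, z_N(γ))` since `negXY` fixes `z`
(value form of abc-iut-L2-d1's `transportFun_thetaCocycleχ_twistedInversion`). [cite: MochizukiEtTh2009, Prop 1.3 p.20] -/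
theorem toTheta_inl_centreRep_gfpInv {γ : Gfp} (hγ : γ ∈ gfpSnd.ker) :
    CurveTheta.toTheta (curveχ p) (SemidirectProduct.inl (centreRep (gfpInv γ))) =
      CurveTheta.toTheta (curveχ p) (SemidirectProduct.inl (centreRep γ)) := by
  have hγ' : gfpInv γ ∈ gfpSnd.ker := by rw [MonoidHom.mem_ker, gfpSnd_gfpInv, inv_eq_one]; exact hγ
  refine toTheta_eq_of_right_eq_one p _ _ (SemidirectProduct.right_inl _) (SemidirectProduct.right_inl _) ?_
  rw [mem_closure_commutator₃_iff_forall_hHat]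
  intro N
  rw [SemidirectProduct.left_inl, SemidirectProduct.left_inl, map_mul, map_inv]
  change levelHom N (centreRep (gfpInv γ)) * (levelHom N (centreRep γ))⁻¹ = 1
  rw [levelHom_centreRep N hγ', levelHom_centreRep N hγ, levelHom_gfpInv, Heis.negXY_z, mul_inv_eq_one]

/-! ## §4. P-C5 in the consumer's `autMap α⁻¹ β⁻¹` form -/

/-- `ι (y · ι x · y⁻¹) = ι y · x · (ι y)⁻¹` (`ι` is an involutive automorphism). [cite: MochizukiEtTh2009, §2 p.36] -/
theorem twistedInversion_conj_twistedInversion (y x : PiTpχ p) :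
    twistedInversion (chi p) (y * twistedInversion (chi p) x * y⁻¹) =
      twistedInversion (chi p) y * x * (twistedInversion (chi p) y)⁻¹ := by
  rw [map_mul, map_mul, map_inv, twistedInversion_twistedInversion]

/-- `Δ_Θ` commutes with `θ(Δ^tp_X)`; in particular `θ(y)⁻¹ · t · θ(y) = θ(ι y)⁻¹ · t · θ(ι y)` for `t ∈ Δ_Θ`
(`ι y · y⁻¹ ∈ Δ^tp_X` as `ι` is over `G_K`). [cite: MochizukiEtTh2009, §1 p.12] -/
theorem conj_toTheta_eq_conj_toTheta_twistedInversion (y : PiTpχ p) {t : (ThetaSetting.modelχ p).GtpTheta}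
    (ht : t ∈ (ThetaSetting.modelχ p).DeltaTheta) :
    ((ThetaSetting.modelχ p).toTheta y)⁻¹ * t * (ThetaSetting.modelχ p).toTheta y =
      ((ThetaSetting.modelχ p).toTheta (twistedInversionTop (chi p) (isInducing_leftRightχ p) y))⁻¹ * t *
        (ThetaSetting.modelχ p).toTheta (twistedInversionTop (chi p) (isInducing_leftRightχ p) y) := by
  set θι := (ThetaSetting.modelχ p).toTheta (twistedInversionTop (chi p) (isInducing_leftRightχ p) y) with hθι
  set θy := (ThetaSetting.modelχ p).toTheta y with hθy
  have hd : twistedInversionTop (chi p) (isInducing_leftRightχ p) y * y⁻¹ ∈ (ThetaSetting.modelχ p).DeltaTemp := by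
    change (ThetaSetting.modelχ p).aug _ = 1
    rw [map_mul, map_inv, aug_twistedInversion_modelχ, mul_inv_cancel]
  have hc : t * (θι * θy⁻¹) = θι * θy⁻¹ * t :=
    (ThetaSetting.modelχ p).ker_thetaToEll_central t ht _ ⟨_, hd, by rw [map_mul, map_inv]⟩
  calc θy⁻¹ * t * θy = θι⁻¹ * (θι * θy⁻¹ * t) * θy := by group
    _ = θι⁻¹ * (t * (θι * θy⁻¹)) * θy := by rw [hc]
    _ = θι⁻¹ * t * θι := by group

/-- **P-C5 at the χ-model, OUTER pair** (`α = conj_y ∘ ι`, `y ∈ Π^tp_X`, any compatible `β`): in the exact shape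
of the binder `hη` of abc-iut-w6-d051's `ofEmbedding_cor28_iii_outer_reduced` / abc-iut-w6-d049's
`ofEmbedding_cor28_i_outer`, **`autMap α⁻¹ β⁻¹ η̈^Θ = ContH1.conj (ι y)⁻¹ η̈^Θ`** for the model class
`η̈^Θ := etaDdχ p` — an equality already at the level of cocycles: `β⁻¹(η(y·ιx·y⁻¹)) = θ(ιy)⁻¹·η(ιy·x·(ιy)⁻¹)·θ(ιy)`
by §3, §2 and `Δ_Θ ⊆ Z((Δ^tp_X)^Θ)`.  (The witness is `(ι y)⁻¹`, not `y⁻¹`: the two conjugates differ by the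
`Z`-translate of degree `2·deg y`.) [cite: MochizukiEtTh2009, Rmk 1.9.1 p.29] -/
theorem autMap_symm_etaDdχ_outer (hC : (ThetaSetting.modelχ p).Compat) (y : PiTpχ p)
    (α : (ThetaSetting.modelχ p).PiTemp ≃ₜ* (ThetaSetting.modelχ p).PiTemp)
    (β : (ThetaSetting.modelχ p).GtpTheta ≃ₜ* (ThetaSetting.modelχ p).GtpTheta)
    (hα : ∀ g, α g = y * twistedInversionTop (chi p) (isInducing_leftRightχ p) g * y⁻¹)
    (hβ : ∀ g, β ((ThetaSetting.modelχ p).toTheta g) = (ThetaSetting.modelχ p).toTheta (α g))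
    (hΔ' : ∀ a, a ∈ (ThetaSetting.modelχ p).DeltaTheta → β.symm a ∈ (ThetaSetting.modelχ p).DeltaTheta)
    (hY : ∀ g, g ∈ (ThetaSetting.modelχ p).GtpYdd → α g ∈ (ThetaSetting.modelχ p).GtpYdd) :
    haveI := hC.GtpYdd_normal
    ContH1Aut.autMap (ThetaSetting.modelχ p).toTheta (ThetaSetting.modelχ p).DeltaTheta α.symm β.symm
        (symm_toTheta_eq hβ) hΔ' (H := (ThetaSetting.modelχ p).GtpYdd) (H' := (ThetaSetting.modelχ p).GtpYdd) hY
        (etaDdχ p) =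
      ContH1.conj (ThetaSetting.modelχ p).toTheta (ThetaSetting.modelχ p).DeltaTheta
        (twistedInversionTop (chi p) (isInducing_leftRightχ p) y)⁻¹ (etaDdχ p) := by
  haveI := hC.GtpYdd_normal
  have hβ' : ∀ g, β ((ThetaSetting.modelχ p).toTheta g) =
      (ThetaSetting.modelχ p).toTheta (y * twistedInversionTop (chi p) (isInducing_leftRightχ p) g * y⁻¹) :=
    fun g => by rw [hβ, hα]
  rw [etaDdχ_eq_mk]
  change ContH1Aut.autMap _ _ _ _ _ _ _ (QuotientGroup.mk _) = ContH1.conj _ _ _ (QuotientGroup.mk _)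
  rw [ContH1Aut.autMap_mk, ContH1.conj_mk]
  congr 1
  refine Subtype.ext (funext fun x => Subtype.ext ?_)
  rw [ContH1Aut.coe_autCocycle_apply, ContH1.conjCocycle_apply, MulAut.conjNormal_apply, coe_thetaCocycleFunχ,
    coe_thetaCocycleFunχ]
  -- the arguments of the two cocycle values
  have hx1 : (α.symm.symm (x : PiTpχ p)) = y * twistedInversionTop (chi p) (isInducing_leftRightχ p) x * y⁻¹ :=
    hα x
  have hx2 : ((MulAut.conjNormal (twistedInversionTop (chi p) (isInducing_leftRightχ p) y)⁻¹⁻¹ x :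
      ↥(ThetaSetting.modelχ p).GtpYdd) : PiTpχ p) =
        twistedInversion (chi p) (y * twistedInversionTop (chi p) (isInducing_leftRightχ p) x * y⁻¹) := by
    rw [MulAut.conjNormal_apply, inv_inv]
    exact (twistedInversion_conj_twistedInversion p y x).symm
  have hxY : y * twistedInversionTop (chi p) (isInducing_leftRightχ p) x * y⁻¹ ∈ (ThetaSetting.modelχ p).GtpY := by
    rw [← hα]; exact (ThetaSetting.modelχ p).GtpYdd_le_GtpY (hY x x.2)
  -- both values are `θ(inl(centreRep (y ιx y⁻¹).left))` (value invariance under `ι`, §3)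
  have hval : CurveTheta.toTheta (curveχ p) (SemidirectProduct.inl (centreRep
      ((MulAut.conjNormal (twistedInversionTop (chi p) (isInducing_leftRightχ p) y)⁻¹⁻¹ x :
        ↥(ThetaSetting.modelχ p).GtpYdd) : PiTpχ p).left)) =
      CurveTheta.toTheta (curveχ p) (SemidirectProduct.inl (centreRep
        (y * twistedInversionTop (chi p) (isInducing_leftRightχ p) x * y⁻¹).left)) := by
    rw [hx2, twistedInversion_left]
    exact toTheta_inl_centreRep_gfpInv p (left_mem_ker_of_mem_GtpY hxY)
  have ht : CurveTheta.toTheta (curveχ p) (SemidirectProduct.inl (centreRep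
      (y * twistedInversionTop (chi p) (isInducing_leftRightχ p) x * y⁻¹).left)) ∈
        (ThetaSetting.modelχ p).DeltaTheta :=
    toTheta_inl_centreRep_mem_ker p (left_mem_ker_of_mem_GtpY hxY)
  rw [hval]
  conv_lhs => rw [show ((⟨α.symm.symm (x : PiTpχ p), hY x x.2⟩ : ↥(ThetaSetting.modelχ p).GtpYdd) : PiTpχ p) =
    y * twistedInversionTop (chi p) (isInducing_leftRightχ p) x * y⁻¹ from hx1]
  rw [symm_apply_eq_conj_of_mem_deltaTheta p y β hβ' ht, map_inv, inv_inv]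
  exact conj_toTheta_eq_conj_toTheta_twistedInversion p y ht

/-- **P-C5 at the χ-model, the INVERSION itself** (`α = ι`, any compatible `β`, any membership proofs):
`autMap ι⁻¹ β⁻¹ η̈^Θ = η̈^Θ` — the `autMap` form of abc-iut-L2-d1's `transport_etaDdχ_twistedInversion` (`σ₀ = 1`).
[cite: MochizukiEtTh2009, Rmk 1.9.1 p.29] -/
theorem autMap_symm_etaDdχ_twistedInversion (hC : (ThetaSetting.modelχ p).Compat)
    (α : (ThetaSetting.modelχ p).PiTemp ≃ₜ* (ThetaSetting.modelχ p).PiTemp)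
    (β : (ThetaSetting.modelχ p).GtpTheta ≃ₜ* (ThetaSetting.modelχ p).GtpTheta)
    (hα : ∀ g, α g = twistedInversionTop (chi p) (isInducing_leftRightχ p) g)
    (hβ : ∀ g, β ((ThetaSetting.modelχ p).toTheta g) = (ThetaSetting.modelχ p).toTheta (α g))
    (hΔ' : ∀ a, a ∈ (ThetaSetting.modelχ p).DeltaTheta → β.symm a ∈ (ThetaSetting.modelχ p).DeltaTheta)
    (hY : ∀ g, g ∈ (ThetaSetting.modelχ p).GtpYdd → α g ∈ (ThetaSetting.modelχ p).GtpYdd) :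
    haveI := hC.GtpYdd_normal
    ContH1Aut.autMap (ThetaSetting.modelχ p).toTheta (ThetaSetting.modelχ p).DeltaTheta α.symm β.symm
        (symm_toTheta_eq hβ) hΔ' (H := (ThetaSetting.modelχ p).GtpYdd) (H' := (ThetaSetting.modelχ p).GtpYdd) hY
        (etaDdχ p) = etaDdχ p := by
  haveI := hC.GtpYdd_normal
  have hα' : ∀ g, α g = 1 * twistedInversionTop (chi p) (isInducing_leftRightχ p) g * 1⁻¹ := fun g => by
    rw [hα, one_mul, inv_one, mul_one]
  have h := autMap_symm_etaDdχ_outer p hC 1 α β hα' hβ hΔ' hY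
  rw [map_one, inv_one, ContH1.conj_one_apply] at h
  exact h

/-- **P-C5 at the χ-model, INNER pair** (`α = conj_y`, `y ∈ Π^tp_X`, any compatible `β`):
`autMap α⁻¹ β⁻¹ η̈^Θ = ContH1.conj y⁻¹ η̈^Θ` — abc-iut-w6-d051's generic `autMap_symm_eq_conj`, the needed shape of
`β` on ALL of `(Π^tp_X)^Θ` coming from `θ`-surjectivity. [cite: MochizukiEtTh2009, Rmk 1.9.1 p.29] -/
theorem autMap_symm_etaDdχ_inner (hC : (ThetaSetting.modelχ p).Compat) (y : PiTpχ p)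
    (α : (ThetaSetting.modelχ p).PiTemp ≃ₜ* (ThetaSetting.modelχ p).PiTemp)
    (β : (ThetaSetting.modelχ p).GtpTheta ≃ₜ* (ThetaSetting.modelχ p).GtpTheta)
    (hα : ∀ g, α g = y * g * y⁻¹)
    (hβ : ∀ g, β ((ThetaSetting.modelχ p).toTheta g) = (ThetaSetting.modelχ p).toTheta (α g))
    (hΔ' : ∀ a, a ∈ (ThetaSetting.modelχ p).DeltaTheta → β.symm a ∈ (ThetaSetting.modelχ p).DeltaTheta)
    (hY : ∀ g, g ∈ (ThetaSetting.modelχ p).GtpYdd → α g ∈ (ThetaSetting.modelχ p).GtpYdd) :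
    haveI := hC.GtpYdd_normal
    ContH1Aut.autMap (ThetaSetting.modelχ p).toTheta (ThetaSetting.modelχ p).DeltaTheta α.symm β.symm
        (symm_toTheta_eq hβ) hΔ' (H := (ThetaSetting.modelχ p).GtpYdd) (H' := (ThetaSetting.modelχ p).GtpYdd) hY
        (etaDdχ p) =
      ContH1.conj (ThetaSetting.modelχ p).toTheta (ThetaSetting.modelχ p).DeltaTheta y⁻¹ (etaDdχ p) := by
  haveI := hC.GtpYdd_normal
  have hβ' : ∀ t, β t = (ThetaSetting.modelχ p).toTheta y * t * ((ThetaSetting.modelχ p).toTheta y)⁻¹ := by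
    intro t
    obtain ⟨u, rfl⟩ := (ThetaSetting.modelχ p).toTheta_surjective t
    rw [hβ, hα, map_mul, map_mul, map_inv]
  exact ContH1Aut.autMap_symm_eq_conj (ThetaSetting.modelχ p).toTheta (ThetaSetting.modelχ p).DeltaTheta y α hα β
    hβ' (symm_toTheta_eq hβ) hΔ' hY (etaDdχ p)

/-! ## §5. P-C5 for EVERY element of `Π^tp_C := Π^tp_X ⋊_ι ℤ/2` and every pair through `inclX` -/

/-- Conjugation in `Π^tp_C = Π^tp_X ⋊_ι ℤ/2` pulled back to `Π^tp_X`: `x · inclX g · x⁻¹ = inclX (x₁ · φ_{x₂}(g) · x₁⁻¹)`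
(`x = (x₁, x₂)`, `φ` = abc-iut-w5-d140's `invActionχ`). [cite: MochizukiEtTh2009, Def 1.7 p.27] -/
theorem conj_inclInvχ (x : PiCInvχ p) (g : PiTpχ p) :
    x * inclInvχ p g * x⁻¹ = inclInvχ p (x.left * invActionχ p x.right g * x.left⁻¹) := by
  change x * SemidirectProduct.inl g * x⁻¹ = SemidirectProduct.inl _
  rw [map_mul, map_mul, map_inv, SemidirectProduct.inl_aut, map_inv]
  conv_lhs => rw [← SemidirectProduct.inl_left_mul_inr_right x]
  rw [mul_inv_rev]
  group

/-- A pair `(α, β)` through `inclX` for `x ∈ Π^tp_C` has `α = conj_{x₁} ∘ φ_{x₂}` on the nose (`inclX` injective).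
[cite: MochizukiEtTh2009, Cor 2.8(iii) p.42] -/
theorem eq_conj_invActionχ_of_inclInvχ (x : PiCInvχ p)
    (α : (ThetaSetting.modelχ p).PiTemp ≃ₜ* (ThetaSetting.modelχ p).PiTemp)
    (hα : ∀ g, inclInvχ p (α g) = x * inclInvχ p g * x⁻¹) (g : PiTpχ p) :
    α g = x.left * invActionχ p x.right g * x.left⁻¹ := by
  have h : inclInvχ p (α g) = inclInvχ p (x.left * invActionχ p x.right g * x.left⁻¹) := by
    rw [hα, conj_inclInvχ]
  exact SemidirectProduct.inl_injective h

/-- **P-C5 AT THE χ-MODEL** (GAP-LEDGER G-w6d049-1, model side): for EVERY `x ∈ Π^tp_C := Π^tp_X ⋊_ι ℤ/2`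
(abc-iut-w5-d140's `PiCInvχ`, `ε_±` = the twisted inversion) and EVERY automorphism pair `(α, β)` through `inclX`
(`inclX ∘ α = conj_x ∘ inclX`, `β ∘ θ = θ ∘ α`), the transported model class is the conjugate of `η̈^Θ` by the
EXPLICIT element `σ₀ := (φ_{x₂} x₁)⁻¹ ∈ Π^tp_X`: `autMap α⁻¹ β⁻¹ η̈^Θ = ContH1.conj σ₀ η̈^Θ`.  The junction
`σ₀ ∈ Π^tp_{Ẋ̲̲}` for `x ∈ Π^tp_{Ċ̲̲}` is the consumer's bookkeeping through abc-iut-L2-d3's `OrbitEmbedding`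
(`φ`-stability of `Π^tp_{Ẋ̲̲}`, cf. abc-iut-L2-d1's `map_Huuχ_twistedInversion`). [cite: MochizukiEtTh2009, Cor 2.8(iii) p.42] -/
theorem exists_autMap_symm_etaDdχ_eq_conj (hC : (ThetaSetting.modelχ p).Compat) (x : PiCInvχ p)
    (α : (ThetaSetting.modelχ p).PiTemp ≃ₜ* (ThetaSetting.modelχ p).PiTemp)
    (β : (ThetaSetting.modelχ p).GtpTheta ≃ₜ* (ThetaSetting.modelχ p).GtpTheta)
    (hα : ∀ g, inclInvχ p (α g) = x * inclInvχ p g * x⁻¹)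
    (hβ : ∀ g, β ((ThetaSetting.modelχ p).toTheta g) = (ThetaSetting.modelχ p).toTheta (α g))
    (hΔ' : ∀ a, a ∈ (ThetaSetting.modelχ p).DeltaTheta → β.symm a ∈ (ThetaSetting.modelχ p).DeltaTheta)
    (hY : ∀ g, g ∈ (ThetaSetting.modelχ p).GtpYdd → α g ∈ (ThetaSetting.modelχ p).GtpYdd) :
    haveI := hC.GtpYdd_normal
    ∃ σ₀ : PiTpχ p, σ₀ = (invActionχ p x.right x.left)⁻¹ ∧
      ContH1Aut.autMap (ThetaSetting.modelχ p).toTheta (ThetaSetting.modelχ p).DeltaTheta α.symm β.symm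
          (symm_toTheta_eq hβ) hΔ' (H := (ThetaSetting.modelχ p).GtpYdd) (H' := (ThetaSetting.modelχ p).GtpYdd) hY
          (etaDdχ p) =
        ContH1.conj (ThetaSetting.modelχ p).toTheta (ThetaSetting.modelχ p).DeltaTheta σ₀ (etaDdχ p) := by
  haveI := hC.GtpYdd_normal
  refine ⟨_, rfl, ?_⟩
  have hαx := eq_conj_invActionχ_of_inclInvχ p x α hα
  rcases invActionχ_eq p x.right with h1 | hι
  · -- `x₂ = 0`: an INNER conjugator, `σ₀ = x₁⁻¹`
    have hα' : ∀ g, α g = x.left * g * x.left⁻¹ := fun g => by rw [hαx, h1, MulAut.one_apply]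
    rw [h1, MulAut.one_apply]
    exact autMap_symm_etaDdχ_inner p hC x.left α β hα' hβ hΔ' hY
  · -- `x₂ = 1`: a genuine OUTER conjugator `x = (x₁, ε_±)`, `σ₀ = (ι x₁)⁻¹`
    have hα' : ∀ g, α g = x.left * twistedInversionTop (chi p) (isInducing_leftRightχ p) g * x.left⁻¹ :=
      fun g => by rw [hαx, hι]; rfl
    rw [hι]
    exact autMap_symm_etaDdχ_outer p hC x.left α β hα' hβ hΔ' hY

end Literature.AnabelianGeometry.EtaleTheta.SettingModel

end
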